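import Mathlib
import Summits.CriticalPhenomena.SAWScalingLimit.Theorems.SAWDefectDecoherenceSectorSlavingDefs
import Summits.CriticalPhenomena.SAWScalingLimit.Theorems.SAWDefectDecoherenceDefectDecoherenceTmStarSums
import Summits.CriticalPhenomena.SAWScalingLimit.Theorems.SAWDefectDecoherenceDefectDecoherenceSsTipRegroupingAux1
import Summits.CriticalPhenomena.SAWScalingLimit.Theorems.SAWDefectDecoherenceDefectDecoherenceSsTipRegroupingAux2
import Summits.CriticalPhenomena.SAWScalingLimit.Theorems.SAWDefectDecoherenceDefectDecoherenceSsDefectSlaving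
import Summits.CriticalPhenomena.SAWScalingLimit.Theorems.SAWDefectDecoherenceDefectDecoherenceSsSourceDiff
import Literature.Probability.LatticeModels.TriangularLatticeProofs
import HarnessLib

/-!
# Weighted star sums decay at the SECTOR LIPSCHITZ rate
(helper `ss_decayBound_weightedStar_of_sectorLipschitz` for the stubs `stub_unstableStarGradient` /
`stub_signalStarGradient` of the line `sector-slaving`, crux `DefectDecoherence`,
stmt-CriticalPhenomena-8549)

The two sources of the `D`-row of the sector system are weighted star sums
`Σ_{t ∈ star Λ v} wt(v,t) · A_ξ(t)` of a clean twisted arrival character `A_ξ = arrivalSum` with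
weights of modulus `≤ 1` and total weight `0` over the star of a `1`-deep vertex (`wt = ē`, `ē²`).
This file proves the GENERIC bookkeeping step `ss_decayBound_weightedStar_of_sectorLipschitz`:
translation covariance of `A_ξ`, the a-priori bound `‖A_ξ(t)‖ ≤ ‖F_0({v,t})‖`, the neighbour
star-mass Harnack inequality `NeighbourMassBound c` and a Lipschitz response
`‖A_ξ(z; TΛ, Ta) - A_ξ(z; Λ, a)‖ ≤ C R^{-θ} M(z)` of `A_ξ` at `R`-deep `z` to lattice translations
`T` of length `≤ 1` of the configuration give the decay of the weighted star sum AT THE SAME RATE: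
`DecayBound (Σ_t wt · A_ξ(t)) C' θ` with `C' = 2^θ (1 + 3 C |c|)`.

Proof.  For `R < 2` the crude bound `‖Σ_t wt A(t)‖ ≤ Σ_t ‖F_0({v,t})‖ = M(v)` and
`1 ≤ 2^θ R^{-θ}` suffice.  For `R ≥ 2` pick `t₁ ∈ star Λ v`; the weights sum to `0`, so
`Σ_t wt A(t) = Σ_t wt (A(t) - A(t₁))`.  Two neighbours `t, t₁` of `v` lie on the same sublattice
(the honeycomb lattice is bipartite) at distance `≤ 1` (`t ∈ {t₁, ρt₁, ρ²t₁}`, `|1 - ζ²|² =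
|1 - ζ⁴|² = 3`, `|c_{t₁} - c_v|² = 1/3`), so the translation `T` with `T t = t₁` has length `≤ 1`;
by covariance `A(t; Λ) = A(t₁; TΛ, Ta)`, and `t₁` is `(R-1)`-deep, whence
`‖A(t) - A(t₁)‖ ≤ C (R-1)^{-θ} M(t₁) ≤ C 2^θ R^{-θ} |c| M(v)`; the star has `≤ 3` elements.

Sources: H. Duminil-Copin, S. Smirnov, Ann. of Math. 175 (2012) (arXiv:1007.0575), §2 (the
observable, translation invariance of the walk weights); the line card
`Cruxes/DefectDecoherence/Lines/sector-slaving.md`.  Deliberately NOT here: the covariance, the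
a-priori bound and the Lipschitz response themselves (hypotheses; the first two are the neighbouring
helpers `ss_translation_covariance`, `ss_norm_arrivalSum_nbr_le`, the last is the open content of
the stubs).
-/

noncomputable section

open scoped BigOperators ComplexConjugate Classical
open Literature.Probability.LatticeModels Literature.Probability.RandomPlanarGeometry.SAW
open Summit.CriticalPhenomena.SAWScalingLimit.Theorems.DefectDecoherence.TipMartingale

namespace Summit.CriticalPhenomena.SAWScalingLimit.Theorems.DefectDecoherence.SectorSlaving

/-! ### Geometry of a star: two neighbours of a vertex -/

/-- Two neighbours of a vertex of the honeycomb lattice lie on the same sublattice (the lattice is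
bipartite: adjacent faces have different types). [folklore] -/
theorem slr_snd_eq_of_adj {v t t₁ : HexVertex} (ht : hexGraph.Adj v t) (ht₁ : hexGraph.Adj v t₁) :
    t.2 = t₁.2 := by
  have h1 : v.2 ≠ t.2 := fun h => not_hexGraph_adj_of_snd_eq_holds v t h ht
  have h2 : v.2 ≠ t₁.2 := fun h => not_hexGraph_adj_of_snd_eq_holds v t₁ h ht₁
  have key : ∀ a b c : Fin 2, a ≠ b → a ≠ c → b = c := by decide
  exact key _ _ _ h1 h2

/-- `|1 - ζ²|² = 3` (`ζ = e^{iπ/3}`, `ζ² = ζ - 1`). [folklore] -/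
theorem slr_normSq_one_sub_triZeta_sq : Complex.normSq (1 - triZeta ^ 2) = 3 := by
  have h3 : Real.sqrt 3 * Real.sqrt 3 = 3 := Real.mul_self_sqrt (by norm_num)
  rw [triZeta_sq, Complex.normSq_apply]
  simp only [Complex.sub_re, Complex.sub_im, Complex.one_re, Complex.one_im, triZeta_re,
    triZeta_im]
  nlinarith [h3]

/-- `|1 - ζ⁴|² = 3` (`ζ⁴ = -ζ`). [folklore] -/
theorem slr_normSq_one_sub_triZeta_pow_four : Complex.normSq (1 - triZeta ^ 4) = 3 := by
  have h3 : Real.sqrt 3 * Real.sqrt 3 = 3 := Real.mul_self_sqrt (by norm_num)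
  have e : triZeta ^ 4 = -triZeta := by
    have : triZeta ^ 4 = (triZeta ^ 2) ^ 2 := by ring
    rw [this, triZeta_sq]
    linear_combination triZeta_sq
  rw [e, Complex.normSq_apply]
  simp only [Complex.sub_re, Complex.sub_im, Complex.one_re, Complex.one_im, Complex.neg_re,
    Complex.neg_im, triZeta_re, triZeta_im]
  nlinarith [h3]

/-- **Two neighbours `t, t₁` of a vertex `v` are at distance `≤ 1`**: `t ∈ {t₁, ρ t₁, ρ² t₁}`
(`ρ = rot3 v`), `c_t - c_v = ζ^{2k} (c_{t₁} - c_v)`, so `|c_{t₁} - c_t|² = |1 - ζ^{2k}|² / 3 ∈ {0, 1}`.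
[folklore] -/
theorem slr_norm_sub_le_one_of_adj {v t t₁ : HexVertex} (ht : hexGraph.Adj v t)
    (ht₁ : hexGraph.Adj v t₁) : ‖hexCenter t₁ - hexCenter t‖ ≤ 1 := by
  have hd : Complex.normSq (hexCenter t₁ - hexCenter v) = 1 / 3 :=
    normSq_hexCenter_sub_of_adj ht₁.symm
  have key : ∀ ζ' : ℂ, Complex.normSq (1 - ζ') = 3 →
      hexCenter t - hexCenter v = ζ' * (hexCenter t₁ - hexCenter v) →
        ‖hexCenter t₁ - hexCenter t‖ ≤ 1 := by
    intro ζ' hζ he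
    have e : hexCenter t₁ - hexCenter t = (1 - ζ') * (hexCenter t₁ - hexCenter v) := by
      linear_combination -he
    refine (pow_le_one_iff_of_nonneg (norm_nonneg _) two_ne_zero).1 ?_
    rw [← Complex.normSq_eq_norm_sq, e, Complex.normSq_mul, hζ, hd]
    norm_num
  rcases (tip_adj_iff ht₁ t).1 ht with rfl | rfl | rfl
  · simp
  · exact key _ slr_normSq_one_sub_triZeta_sq (hexCenter_rot3_sub v t₁)
  · refine key _ slr_normSq_one_sub_triZeta_pow_four ?_
    rw [hexCenter_rot3_sub, hexCenter_rot3_sub]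
    ring

/-- The star of a vertex has at most three elements. [folklore] -/
theorem slr_card_star_le_three {Λ : Finset HexVertex} {v t₁ : HexVertex}
    (ht₁ : hexGraph.Adj v t₁) : (star Λ v).card ≤ 3 := by
  have hsub : star Λ v ⊆ {t₁, rot3 v t₁, rot3 v (rot3 v t₁)} := fun t ht => by
    have h := (tip_adj_iff ht₁ t).1 (tip_mem_star.1 ht).2
    simpa only [Finset.mem_insert, Finset.mem_singleton] using h
  exact (Finset.card_le_card hsub).trans Finset.card_le_three

/-! ### Depth and exponent bookkeeping -/

/-- `(R-1)^{-θ} ≤ 2^θ R^{-θ}` for `R ≥ 2`, `θ ≥ 0` (since `R/2 ≤ R - 1`). [folklore] -/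
theorem slr_rpow_sub_one_le {R θ : ℝ} (hR : 2 ≤ R) (hθ : 0 ≤ θ) :
    (R - 1) ^ (-θ) ≤ 2 ^ θ * R ^ (-θ) := by
  have hR0 : 0 ≤ R := by linarith
  calc (R - 1) ^ (-θ) ≤ (R / 2) ^ (-θ) :=
        Real.rpow_le_rpow_of_nonpos (by linarith) (by linarith) (by linarith)
    _ = 2 ^ θ * R ^ (-θ) := by
        rw [Real.div_rpow hR0 zero_le_two, Real.rpow_neg zero_le_two, div_inv_eq_mul, mul_comm]

/-- `1 ≤ 2^θ R^{-θ}` for `0 < R ≤ 2`, `θ ≥ 0`. [folklore] -/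
theorem slr_one_le_rpow {R θ : ℝ} (hR0 : 0 < R) (hR : R ≤ 2) (hθ : 0 ≤ θ) :
    1 ≤ 2 ^ θ * R ^ (-θ) := by
  rw [Real.rpow_neg hR0.le, ← div_eq_mul_inv, le_div_iff₀ (Real.rpow_pos_of_pos hR0 θ), one_mul]
  exact Real.rpow_le_rpow hR0.le hR hθ

/-! ### The difference of the arrival character across a star -/

/-- **One-step difference from the Lipschitz response.**  If `A_ξ` is covariant under the
lattice translations and responds Lipschitz-continuously (rate `θ`, constant `C`, against the star
mass) to translations of length `≤ 1` of the configuration, then for two neighbours `t, t₁` of an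
`R`-deep vertex `v` (`R ≥ 2`) of a simply connected `Λ` with adjacent boundary root `s(u,w)`:
`‖A_ξ(t) - A_ξ(t₁)‖ ≤ C (R-1)^{-θ} M(t₁)`.  (Translate `t ↦ t₁`: `A(t; Λ) = A(t₁; TΛ, Ta)`, and `t₁`
is `(R-1)`-deep.) [folklore] -/
theorem slr_norm_arrivalSum_sub_le {ξ C θ : ℝ}
    (h3 : ∀ t t' : HexVertex, t.2 = t'.2 →
      ∃ (T : hexGraph ≃g hexGraph) (β : ℂ), T t = t' ∧
        ∀ f : HexVertex, hexCenter (T f) = hexCenter f + β)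
    (h4 : ∀ (T : hexGraph ≃g hexGraph) (β : ℂ), (∀ f : HexVertex, hexCenter (T f) = hexCenter f + β) →
      ∀ (Λ : Finset HexVertex) (a : Sym2 HexVertex) (θa : ℝ) (z : HexVertex),
        arrivalSum (Λ.image T) (a.map T) θa ξ (T z) = arrivalSum Λ a θa ξ z)
    (h9 : ∀ (T : hexGraph ≃g hexGraph) (β : ℂ), (∀ f : HexVertex, hexCenter (T f) = hexCenter f + β) →
      ‖β‖ ≤ 1 →
      ∀ (Λ : Finset HexVertex), hexDomainSimplyConnected Λ →
        ∀ (u w : HexVertex), hexGraph.Adj u w → u ∉ Λ → w ∈ Λ →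
          ∀ (z : HexVertex) (R : ℝ), 1 ≤ R → Deep Λ z R →
            ‖arrivalSum (Λ.image T) ((s(u, w) : Sym2 HexVertex).map T) (rootAngle u w) ξ z -
                arrivalSum Λ s(u, w) (rootAngle u w) ξ z‖ ≤ C * R ^ (-θ) * mass Λ u w z)
    {Λ : Finset HexVertex} (hΛ : hexDomainSimplyConnected Λ) {u w v t t₁ : HexVertex}
    (huw : hexGraph.Adj u w) (hu : u ∉ Λ) (hw : w ∈ Λ) {R : ℝ} (hR : 2 ≤ R) (hdeep : Deep Λ v R)
    (ht : hexGraph.Adj v t) (ht₁ : hexGraph.Adj v t₁) :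
    ‖arrivalSum Λ s(u, w) (rootAngle u w) ξ t - arrivalSum Λ s(u, w) (rootAngle u w) ξ t₁‖ ≤
      C * (R - 1) ^ (-θ) * mass Λ u w t₁ := by
  obtain ⟨T, β, hTt, hTβ⟩ := h3 t t₁ (slr_snd_eq_of_adj ht ht₁)
  have hβ : ‖β‖ ≤ 1 := by
    have e : β = hexCenter t₁ - hexCenter t := by
      have h := hTβ t
      rw [hTt] at h
      linear_combination -h
    rw [e]
    exact slr_norm_sub_le_one_of_adj ht ht₁
  have hcov := h4 T β hTβ Λ s(u, w) (rootAngle u w) t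
  rw [hTt] at hcov
  rw [← hcov]
  exact h9 T β hTβ hβ Λ hΛ u w huw hu hw t₁ (R - 1) (by linarith) (slave_deep_of_adj hdeep ht₁)

/-! ### The reduction -/

/-- **Registered helper `ss_decayBound_weightedStar_of_sectorLipschitz` (line `sector-slaving`,
c4 helper H2): a weighted star sum of the clean twisted arrival character decays at the SECTOR
LIPSCHITZ rate.**  Let `wt(v,t)` be weights of modulus `≤ 1` with `Σ_{t ∈ star Λ v} wt(v,t) = 0` at
every `1`-deep `v`.  Assume: lattice translations act transitively on each sublattice (h3) and leave
`A_ξ = arrivalSum` covariant (h4); the a-priori bound `‖A_ξ(t)‖ ≤ ‖F_0({v,t})‖` for `t ∈ star Λ v`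
(h5); the neighbour star-mass Harnack inequality `NeighbourMassBound c`; `0 ≤ C`, `0 < θ`; and the
SECTOR LIPSCHITZ response: for every translation `T` of length `≤ 1`, every simply connected `Λ` with
adjacent boundary root `s(u,w)` and every `R`-deep `z` (`R ≥ 1`),
`‖A_ξ(z; TΛ, T s(u,w)) - A_ξ(z; Λ, s(u,w))‖ ≤ C R^{-θ} M(Λ,u,w,z)`.  Then
`DecayBound (Σ_{t ∈ star Λ v} wt(v,t) A_ξ(t)) C' θ` for some `C'` (namely `2^θ (1 + 3 C |c|)`).
The Lipschitz response is the open content of the stubs `stub_unstableStarGradient` /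
`stub_signalStarGradient`; nothing about it is proved here. [folklore] -/
theorem ss_decayBound_weightedStar_of_sectorLipschitz :
    ∀ (ξ c C θ : ℝ) (wt : HexVertex → HexVertex → ℂ),
      (∀ v t : HexVertex, ‖wt v t‖ ≤ 1) →
      (∀ (Λ : Finset HexVertex) (v : HexVertex), Deep Λ v 1 → ∑ t ∈ star Λ v, wt v t = 0) →
      (∀ t t' : HexVertex, t.2 = t'.2 →
        ∃ (T : hexGraph ≃g hexGraph) (β : ℂ), T t = t' ∧
          ∀ f : HexVertex, hexCenter (T f) = hexCenter f + β) →
      (∀ (T : hexGraph ≃g hexGraph) (β : ℂ), (∀ f : HexVertex, hexCenter (T f) = hexCenter f + β) →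
        ∀ (Λ : Finset HexVertex) (a : Sym2 HexVertex) (θa : ℝ) (z : HexVertex),
          arrivalSum (Λ.image T) (a.map T) θa ξ (T z) = arrivalSum Λ a θa ξ z) →
      (∀ (Λ : Finset HexVertex) (u w v t : HexVertex) (θa : ℝ), u ∉ Λ → w ∈ Λ → hexGraph.Adj u w →
        v ∈ Λ → t ∈ star Λ v →
          ‖arrivalSum Λ s(u, w) θa ξ t‖ ≤ ‖hexParafermionicObservable Λ s(u, w) xc 0 s(v, t)‖) →
      NeighbourMassBound c → 0 ≤ C → 0 < θ →
      (∀ (T : hexGraph ≃g hexGraph) (β : ℂ), (∀ f : HexVertex, hexCenter (T f) = hexCenter f + β) →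
        ‖β‖ ≤ 1 →
        ∀ (Λ : Finset HexVertex), hexDomainSimplyConnected Λ →
          ∀ (u w : HexVertex), hexGraph.Adj u w → u ∉ Λ → w ∈ Λ →
            ∀ (z : HexVertex) (R : ℝ), 1 ≤ R → Deep Λ z R →
              ‖arrivalSum (Λ.image T) ((s(u, w) : Sym2 HexVertex).map T) (rootAngle u w) ξ z -
                  arrivalSum Λ s(u, w) (rootAngle u w) ξ z‖ ≤ C * R ^ (-θ) * mass Λ u w z) →
      ∃ C' : ℝ, DecayBound
        (fun Λ u w v => ∑ t ∈ star Λ v, wt v t * arrivalSum Λ s(u, w) (rootAngle u w) ξ t) C' θ := by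
  intro ξ c C θ wt h1 h2 h3 h4 h5 h6 hC hθ h9
  refine ⟨2 ^ θ * (1 + 3 * C * |c|), ?_⟩
  intro Λ hΛ u w huw hu hw v R hR hdeep
  have hM0 : 0 ≤ mass Λ u w v := mass_nonneg Λ u w v
  have h2θ : 0 < (2 : ℝ) ^ θ := Real.rpow_pos_of_pos two_pos θ
  have hR0 : 0 < R := by linarith
  have hRθ : 0 ≤ R ^ (-θ) := Real.rpow_nonneg hR0.le _
  have hCc : 0 ≤ C * |c| := mul_nonneg hC (abs_nonneg c)
  have hv : v ∈ Λ := hdeep v (by rw [dist_self]; exact hR0.le)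
  by_cases hR2 : R < 2
  · -- the crude case `R < 2`: `‖Σ_t wt A(t)‖ ≤ M(v) ≤ 2^θ R^{-θ} M(v)`
    have key : ‖∑ t ∈ star Λ v, wt v t * arrivalSum Λ s(u, w) (rootAngle u w) ξ t‖ ≤
        mass Λ u w v := by
      refine (norm_sum_le _ _).trans (Finset.sum_le_sum fun t ht => ?_)
      rw [norm_mul]
      refine (mul_le_of_le_one_left (norm_nonneg _) (h1 v t)).trans ?_
      exact h5 Λ u w v t (rootAngle u w) hu hw huw hv ht
    refine key.trans (le_mul_of_one_le_left hM0 ?_)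
    calc (1 : ℝ) ≤ 2 ^ θ * R ^ (-θ) := slr_one_le_rpow hR0 hR2.le hθ.le
      _ ≤ 2 ^ θ * R ^ (-θ) + 2 ^ θ * R ^ (-θ) * (3 * (C * |c|)) :=
          le_add_of_nonneg_right (mul_nonneg (mul_nonneg h2θ.le hRθ) (mul_nonneg zero_le_three hCc))
      _ = 2 ^ θ * (1 + 3 * C * |c|) * R ^ (-θ) := by ring
  · -- the generic case `R ≥ 2`
    rw [not_lt] at hR2
    have hdeep1 : Deep Λ v 1 := by
      intro y hy
      exact hdeep y (by linarith)
    have hdeep2 : Deep Λ v 2 := by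
      intro y hy
      exact hdeep y (by linarith)
    rcases (star Λ v).eq_empty_or_nonempty with hst | ⟨t₁, ht₁⟩
    · have key : ‖∑ t ∈ star Λ v, wt v t * arrivalSum Λ s(u, w) (rootAngle u w) ξ t‖ = 0 := by
        rw [hst, Finset.sum_empty, norm_zero]
      refine key.trans_le ?_
      exact mul_nonneg (mul_nonneg (mul_nonneg h2θ.le (by linarith)) hRθ) hM0
    · have ht₁adj : hexGraph.Adj v t₁ := (tip_mem_star.1 ht₁).2
      have hK0 : 0 ≤ C * (R - 1) ^ (-θ) * mass Λ u w t₁ :=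
        mul_nonneg (mul_nonneg hC (Real.rpow_nonneg (by linarith) _)) (mass_nonneg _ _ _ _)
      have hterm : ∀ t ∈ star Λ v,
          ‖wt v t * (arrivalSum Λ s(u, w) (rootAngle u w) ξ t -
            arrivalSum Λ s(u, w) (rootAngle u w) ξ t₁)‖ ≤ C * (R - 1) ^ (-θ) * mass Λ u w t₁ := by
        intro t ht
        rw [norm_mul]
        refine (mul_le_of_le_one_left (norm_nonneg _) (h1 v t)).trans ?_
        exact slr_norm_arrivalSum_sub_le h3 h4 h9 hΛ huw hu hw hR2 hdeep (tip_mem_star.1 ht).2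
          ht₁adj
      have hmass : mass Λ u w t₁ ≤ |c| * mass Λ u w v := by
        calc mass Λ u w t₁ ≤ ∑ t ∈ star Λ v, mass Λ u w t :=
              Finset.single_le_sum (fun t _ => mass_nonneg Λ u w t) ht₁
          _ ≤ c * mass Λ u w v := h6 Λ hΛ u w huw hu hw v hdeep2
          _ ≤ |c| * mass Λ u w v := mul_le_mul_of_nonneg_right (le_abs_self c) hM0
      have hKle : C * (R - 1) ^ (-θ) * mass Λ u w t₁ ≤
          C * (2 ^ θ * R ^ (-θ)) * (|c| * mass Λ u w v) := by
        refine mul_le_mul ?_ hmass (mass_nonneg _ _ _ _) (mul_nonneg hC (mul_nonneg h2θ.le hRθ))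
        exact mul_le_mul_of_nonneg_left (slr_rpow_sub_one_le hR2 hθ.le) hC
      have hcard : ((star Λ v).card : ℝ) ≤ 3 := by
        exact_mod_cast slr_card_star_le_three ht₁adj
      have key : ‖∑ t ∈ star Λ v, wt v t * arrivalSum Λ s(u, w) (rootAngle u w) ξ t‖ ≤
          3 * (C * (2 ^ θ * R ^ (-θ)) * (|c| * mass Λ u w v)) := by
        rw [ss_sum_weight_mul_eq_diff (star Λ v) (wt v) (arrivalSum Λ s(u, w) (rootAngle u w) ξ)
          (arrivalSum Λ s(u, w) (rootAngle u w) ξ t₁) (h2 Λ v hdeep1)]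
        calc ‖∑ t ∈ star Λ v, wt v t * (arrivalSum Λ s(u, w) (rootAngle u w) ξ t -
                arrivalSum Λ s(u, w) (rootAngle u w) ξ t₁)‖
            ≤ ∑ t ∈ star Λ v, ‖wt v t * (arrivalSum Λ s(u, w) (rootAngle u w) ξ t -
                arrivalSum Λ s(u, w) (rootAngle u w) ξ t₁)‖ := norm_sum_le _ _
          _ ≤ (star Λ v).card • (C * (R - 1) ^ (-θ) * mass Λ u w t₁) :=
              Finset.sum_le_card_nsmul _ _ _ hterm
          _ = (star Λ v).card * (C * (R - 1) ^ (-θ) * mass Λ u w t₁) := nsmul_eq_mul _ _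
          _ ≤ 3 * (C * (2 ^ θ * R ^ (-θ)) * (|c| * mass Λ u w v)) :=
              mul_le_mul hcard hKle hK0 (by norm_num)
      refine key.trans ?_
      have hslack : 0 ≤ 2 ^ θ * R ^ (-θ) * mass Λ u w v := mul_nonneg (mul_nonneg h2θ.le hRθ) hM0
      linarith [hslack]

/-- The same reduction with the Lipschitz response assumed for all lattice translations of length
`≤ 2` (a formally STRONGER hypothesis than the `≤ 1` of
`ss_decayBound_weightedStar_of_sectorLipschitz`, and the form in which the line's assembly states
SECTOR LIPSCHITZ regularity): immediate specialisation. [folklore] -/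
theorem ss_decayBound_weightedStar_of_sectorLipschitz_two (ξ c C θ : ℝ)
    (wt : HexVertex → HexVertex → ℂ) (h1 : ∀ v t : HexVertex, ‖wt v t‖ ≤ 1)
    (h2 : ∀ (Λ : Finset HexVertex) (v : HexVertex), Deep Λ v 1 → ∑ t ∈ star Λ v, wt v t = 0)
    (h3 : ∀ t t' : HexVertex, t.2 = t'.2 →
      ∃ (T : hexGraph ≃g hexGraph) (β : ℂ), T t = t' ∧
        ∀ f : HexVertex, hexCenter (T f) = hexCenter f + β)
    (h4 : ∀ (T : hexGraph ≃g hexGraph) (β : ℂ), (∀ f : HexVertex, hexCenter (T f) = hexCenter f + β) →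
      ∀ (Λ : Finset HexVertex) (a : Sym2 HexVertex) (θa : ℝ) (z : HexVertex),
        arrivalSum (Λ.image T) (a.map T) θa ξ (T z) = arrivalSum Λ a θa ξ z)
    (h5 : ∀ (Λ : Finset HexVertex) (u w v t : HexVertex) (θa : ℝ), u ∉ Λ → w ∈ Λ →
      hexGraph.Adj u w → v ∈ Λ → t ∈ star Λ v →
        ‖arrivalSum Λ s(u, w) θa ξ t‖ ≤ ‖hexParafermionicObservable Λ s(u, w) xc 0 s(v, t)‖)
    (h6 : NeighbourMassBound c) (hC : 0 ≤ C) (hθ : 0 < θ)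
    (h9 : ∀ (T : hexGraph ≃g hexGraph) (β : ℂ), (∀ f : HexVertex, hexCenter (T f) = hexCenter f + β) →
      ‖β‖ ≤ 2 →
      ∀ (Λ : Finset HexVertex), hexDomainSimplyConnected Λ →
        ∀ (u w : HexVertex), hexGraph.Adj u w → u ∉ Λ → w ∈ Λ →
          ∀ (z : HexVertex) (R : ℝ), 1 ≤ R → Deep Λ z R →
            ‖arrivalSum (Λ.image T) ((s(u, w) : Sym2 HexVertex).map T) (rootAngle u w) ξ z -
                arrivalSum Λ s(u, w) (rootAngle u w) ξ z‖ ≤ C * R ^ (-θ) * mass Λ u w z) :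
    ∃ C' : ℝ, DecayBound
      (fun Λ u w v => ∑ t ∈ star Λ v, wt v t * arrivalSum Λ s(u, w) (rootAngle u w) ξ t) C' θ :=
  ss_decayBound_weightedStar_of_sectorLipschitz ξ c C θ wt h1 h2 h3 h4 h5 h6 hC hθ
    fun T β hTβ hβ => h9 T β hTβ (hβ.trans one_le_two)

end Summit.CriticalPhenomena.SAWScalingLimit.Theorems.DefectDecoherence.SectorSlaving

end
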